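import Mathlib

/-!
# P5BlockCensus — the BLOCK METHOD for balanced-set censuses of cyclotomic CM types, generic and kernel-checkable

p5 (g21), 2026-08-29.  Supporting artefact (R-5): finite combinatorics only; nothing here is an algebraicity statement.
The generic theory behind `P5AprimeCensus.lean` (the sixteenfold `A′`) and `P5I4Census.lean` (the instance I-4), written
once for any CM type of a cyclotomic field: the data `D : Data` lists the modulus `M`, the units, the CM type `Tp`, a
subgroup `H` (as a list of residues), one coset representative per block (`creps`), and a table of separating
functionals; the finitely many facts the method needs are the decidable proposition `Facts D`, proved by
`decide +kernel` for each concrete type; the theorems below are then generic.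

THE METHOD.  A subset `S` of the units is BALANCED if for every unit `k` exactly half of `S` is carried into `Tp` by
multiplication by `k`.  Balance is linear: `S` is balanced iff `sig S k = Σ_{s ∈ S} ε(k s)` vanishes for every unit
`k`, `ε = 2·1_{Tp} − 1`.  Since `Tp` is a CM type, `ε(k s) + ε(k (−s)) = 0`, so `sig S k = Σ_{t ∈ R} n_S(t) ε(k t)` over
the pair representatives `R` (the cosets `cH`, `c ∈ creps`), `n_S(t) = [t ∈ S] − [−t ∈ S] ∈ {−1, 0, 1}`.  An integer
functional `q` on the units with `Σ_k q(k) ε(k a) = d`, `Σ_k q(k) ε(k b) = −d` and `0` at the other representatives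
forces `n_S(a) = n_S(b)` on a balanced `S`; a chain of such functionals along each coset forces `n_S` constant on the
coset (`n_const_of_balanced`); conversely a set with `n_S` constant on every coset is balanced because every coset of
`H` is balanced (`balanced_of_n_const`).  THE BLOCK THEOREM `balanced_iff_blocks`: `S ⊆ U` is balanced iff on each
block `cH ∪ −cH` it is a union of conjugate pairs, or the coset `cH`, or the coset `−cH`.
-/

namespace HodgeRepro0.P5BlockCensus

/-- The data of a block census: the modulus, the units, the CM type, the subgroup `H` (as residues, `1` first),
one coset representative per block, the functional table (entries `(a, b, q)`: `q` separates `a` from `b`) and the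
separating value `d`. -/
structure Data where
  /-- the modulus `M` -/
  M : ℕ
  /-- the units of `ℤ/M` -/
  units : List ℕ
  /-- the CM type -/
  Tp : List ℕ
  /-- the subgroup `H` -/
  H : List ℕ
  /-- one representative per block `cH ∪ −cH` -/
  creps : List ℕ
  /-- the separating functionals `(a, b, q)`, `q` an association list `(unit, value)` -/
  qtab : List (ℕ × ℕ × List (ℕ × ℤ))
  /-- the pinning functionals `(a, q)` of a nondegenerate type (`q` has value `d` at `a`, `0` at the other
  representatives); empty when the table `qtab` is used -/
  ptab : List (ℕ × List (ℕ × ℤ))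
  /-- the separating value -/
  d : ℤ

variable (D : Data)

/-- `ε(u) = 1` if `u mod M ∈ Tp`, `−1` otherwise. -/
def eps (u : ℕ) : ℤ := if u % D.M ∈ D.Tp then 1 else -1

/-- The conjugate of a residue: `u ↦ M − u`. -/
def conj (u : ℕ) : ℕ := D.M - u

/-- The coset `cH`. -/
def coset (c : ℕ) : List ℕ := D.H.map (fun h => (c * h) % D.M)

/-- The pair representatives: the cosets of the representatives, concatenated. -/
def R : List ℕ := (D.creps.map (coset D)).flatten

/-- The units as a finset. -/
def U : Finset ℕ := D.units.toFinset

/-- The pair representatives as a finset. -/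
def Rf : Finset ℕ := (R D).toFinset

/-- The signature of `S` at `k`: `Σ_{s ∈ S} ε(k s)`. -/
def sig (S : Finset ℕ) (k : ℕ) : ℤ := ∑ s ∈ S, eps D (k * s)

/-- BALANCED: for every unit `k`, multiplication by `k` carries exactly half of `S` into `Tp`. -/
abbrev Balanced (S : Finset ℕ) : Prop :=
  ∀ k ∈ D.units, 2 * (S.filter (fun s => (k * s) % D.M ∈ D.Tp)).card = S.card

/-- `n_S(t) = [t ∈ S] − [conj t ∈ S]`. -/
def nS (S : Finset ℕ) (t : ℕ) : ℤ := (if t ∈ S then 1 else 0) - (if conj D t ∈ S then 1 else 0)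

/-- The value of an association-list functional at `k`. -/
def qval (q : List (ℕ × ℤ)) (k : ℕ) : ℤ := (q.lookup k).getD 0

/-- The pairing of a functional with `(ε(k t))_k`, as a list sum. -/
def wL (q : List (ℕ × ℤ)) (t : ℕ) : ℤ := (D.units.map (fun k => qval q k * eps D (k * t))).sum

/-- The pairing of a functional with `(ε(k t))_k`, as a finset sum over `U`. -/
def w (q : List (ℕ × ℤ)) (t : ℕ) : ℤ := ∑ k ∈ U D, qval q k * eps D (k * t)

/-- On the block of `c`, `S` is a union of conjugate pairs. -/
abbrev PairsOn (S : Finset ℕ) (c : ℕ) : Prop := ∀ t ∈ coset D c, (t ∈ S ↔ conj D t ∈ S)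

/-- On the block of `c`, `S` is exactly the coset `cH`. -/
abbrev CosetOn (S : Finset ℕ) (c : ℕ) : Prop := ∀ t ∈ coset D c, t ∈ S ∧ conj D t ∉ S

/-- On the block of `c`, `S` is exactly the conjugate coset `−cH`. -/
abbrev ConjCosetOn (S : Finset ℕ) (c : ℕ) : Prop := ∀ t ∈ coset D c, t ∉ S ∧ conj D t ∈ S

/-- The list is CHAINED by the table: consecutive elements `a, b` are separated by an entry `(a, b, q)`. -/
def chainedB (D : Data) : List ℕ → Bool
  | [] => true
  | [_] => true
  | a :: b :: rest => D.qtab.any (fun e => decide (e.1 = a) && decide (e.2.1 = b)) && chainedB D (b :: rest)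

/-- A function agreeing across every entry of the table is constant on a chained list. -/
theorem const_of_chainedB (D : Data) (f : ℕ → ℤ) (hf : ∀ e ∈ D.qtab, f e.1 = f e.2.1) :
    ∀ l : List ℕ, chainedB D l = true → ∀ t ∈ l, ∀ t' ∈ l, f t = f t'
  | [] => by simp
  | [a] => by
      intro _ t ht t' ht'
      rw [List.mem_singleton] at ht ht'
      rw [ht, ht']
  | a :: b :: rest => by
      intro h t ht t' ht'
      simp only [chainedB, Bool.and_eq_true, List.any_eq_true, decide_eq_true_eq] at h
      obtain ⟨⟨e, he, hea, heb⟩, hrest⟩ := h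
      have hab : f a = f b := by rw [← hea, ← heb]; exact hf e he
      have ih := const_of_chainedB D f hf (b :: rest) hrest
      rcases List.mem_cons.mp ht with rfl | ht1 <;> rcases List.mem_cons.mp ht' with rfl | ht2
      · rfl
      · rw [hab]; exact ih b (List.mem_cons_self ..) t' ht2
      · rw [ih t ht1 b (List.mem_cons_self ..), hab]
      · exact ih t ht1 t' ht2

/-- `n_S` takes the values `−1, 0, 1`. -/
theorem nS_cases (D : Data) (S : Finset ℕ) (t : ℕ) : nS D S t = -1 ∨ nS D S t = 0 ∨ nS D S t = 1 := by
  unfold nS; split_ifs <;> simp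

/-- THE CORE FACTS shared by both theorems, all decidable for concrete data: `Tp` is a CM type; the units are the
representatives and their conjugates, disjointly, `conj` injective on the representatives; the lists have no
duplicates. -/
abbrev Core : Prop :=
  (∀ k ∈ D.units, ∀ s ∈ D.units, eps D (k * s) + eps D (k * conj D s) = 0) ∧
  (R D).Nodup ∧ D.units.Nodup ∧
  U D = Rf D ∪ (Rf D).image (conj D) ∧
  Disjoint (Rf D) ((Rf D).image (conj D)) ∧
  (∀ x ∈ Rf D, ∀ y ∈ Rf D, conj D x = conj D y → x = y) ∧
  (∀ t ∈ Rf D, t ∈ D.units)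

/-- THE FACTS of the block method (a subgroup `H` with balanced cosets): the core facts; the functional table; `d ≠ 0`;
the table's entries are distinct representatives; every coset of `creps` is balanced; each coset list is chained by
the table; `c ∈ cH`. -/
abbrev Facts : Prop :=
  Core D ∧
  (∀ e ∈ D.qtab, ∀ t ∈ R D, wL D e.2.2 t = if t = e.1 then D.d else if t = e.2.1 then -D.d else 0) ∧
  D.d ≠ 0 ∧
  (∀ e ∈ D.qtab, e.1 ∈ R D ∧ e.2.1 ∈ R D ∧ e.1 ≠ e.2.1) ∧
  (∀ c ∈ D.creps, ∀ k ∈ D.units, ((coset D c).map (fun t => eps D (k * t))).sum = 0) ∧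
  (∀ c ∈ D.creps, chainedB D (coset D c) = true) ∧
  (∀ c ∈ D.creps, c ∈ coset D c)

variable {D}

section
variable (hC : Core D)
include hC

/-- `Tp` is a CM type: `ε(k s) + ε(k · conj s) = 0` for all units `k`, `s`. -/
theorem c_eps_conj : ∀ k ∈ D.units, ∀ s ∈ D.units, eps D (k * s) + eps D (k * conj D s) = 0 := hC.1
/-- The representatives are distinct. -/
theorem c_R_nodup : (R D).Nodup := hC.2.1
/-- The units are distinct. -/
theorem c_units_nodup : D.units.Nodup := hC.2.2.1
/-- The units are the representatives and their conjugates. -/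
theorem c_U_eq : U D = Rf D ∪ (Rf D).image (conj D) := hC.2.2.2.1
/-- Representatives and conjugates are disjoint. -/
theorem c_Rf_disj : Disjoint (Rf D) ((Rf D).image (conj D)) := hC.2.2.2.2.1
/-- `conj` is injective on the representatives. -/
theorem c_conj_inj : ∀ x ∈ Rf D, ∀ y ∈ Rf D, conj D x = conj D y → x = y := hC.2.2.2.2.2.1
/-- Every representative is a unit. -/
theorem c_Rf_sub_U : ∀ t ∈ Rf D, t ∈ D.units := hC.2.2.2.2.2.2
end

section
variable (hF : Facts D)
include hF

/-- The core facts. -/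
theorem f_core : Core D := hF.1
/-- The functional table: `w_q(t) = d` at `a`, `−d` at `b`, `0` at the other representatives, for each entry `(a, b, q)`. -/
theorem f_w_table : ∀ e ∈ D.qtab, ∀ t ∈ R D,
    wL D e.2.2 t = if t = e.1 then D.d else if t = e.2.1 then -D.d else 0 := hF.2.1
/-- The separating value is non-zero. -/
theorem f_d : D.d ≠ 0 := hF.2.2.1
/-- Each entry's `a`, `b` are distinct representatives. -/
theorem f_entry : ∀ e ∈ D.qtab, e.1 ∈ R D ∧ e.2.1 ∈ R D ∧ e.1 ≠ e.2.1 := hF.2.2.2.1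
/-- Every coset `cH`, `c ∈ creps`, is balanced: `Σ_{t ∈ cH} ε(k t) = 0` for every unit `k`. -/
theorem f_coset_sig : ∀ c ∈ D.creps, ∀ k ∈ D.units, ((coset D c).map (fun t => eps D (k * t))).sum = 0 :=
  hF.2.2.2.2.1
/-- Each coset list is chained by the table. -/
theorem f_chain : ∀ c ∈ D.creps, chainedB D (coset D c) = true := hF.2.2.2.2.2.1
/-- `c ∈ cH` for each `c ∈ creps`. -/
theorem f_creps_mem_coset : ∀ c ∈ D.creps, c ∈ coset D c := hF.2.2.2.2.2.2
end

/-! ### Balance is linear -/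

/-- `sig S k = 2·|{s ∈ S : k s mod M ∈ Tp}| − |S|`. -/
theorem sig_eq (S : Finset ℕ) (k : ℕ) :
    sig D S k = 2 * ((S.filter (fun s => (k * s) % D.M ∈ D.Tp)).card : ℤ) - (S.card : ℤ) := by
  have h1 : ∀ s, eps D (k * s) = 2 * (if (k * s) % D.M ∈ D.Tp then (1 : ℤ) else 0) - 1 := by
    intro s; unfold eps; split_ifs <;> simp
  unfold sig
  simp_rw [h1]
  rw [Finset.sum_sub_distrib, ← Finset.mul_sum, Finset.sum_boole, Finset.sum_const]
  simp

/-- BALANCED ⟺ every signature vanishes. -/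
theorem balanced_iff_sig (S : Finset ℕ) : Balanced D S ↔ ∀ k ∈ D.units, sig D S k = 0 := by
  unfold Balanced
  constructor
  · intro h k hk
    rw [sig_eq]
    have := h k hk
    omega
  · intro h k hk
    have := h k hk
    rw [sig_eq] at this
    omega

/-! ### The pair representatives -/

section
variable (hC : Core D)
include hC

/-- A sum over the units is a sum over the representatives of the pair terms. -/
theorem sum_pairs (f : ℕ → ℤ) : ∑ s ∈ U D, f s = ∑ t ∈ Rf D, (f t + f (conj D t)) := by
  rw [c_U_eq hC, Finset.sum_union (c_Rf_disj hC), Finset.sum_image (c_conj_inj hC), Finset.sum_add_distrib]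

/-- The pair term of `S` at a representative `t`. -/
theorem pair_term (S : Finset ℕ) (k : ℕ) (hk : k ∈ D.units) (t : ℕ) (ht : t ∈ D.units) :
    (if t ∈ S then eps D (k * t) else 0) + (if conj D t ∈ S then eps D (k * conj D t) else 0) =
      nS D S t * eps D (k * t) := by
  have h := c_eps_conj hC k hk t ht
  unfold nS
  split_ifs <;> linarith

/-- For `S ⊆ U`: `sig S k = Σ_{t ∈ R} n_S(t) ε(k t)`. -/
theorem sig_eq_sum_R (S : Finset ℕ) (hS : S ⊆ U D) (k : ℕ) (hk : k ∈ D.units) :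
    sig D S k = ∑ t ∈ Rf D, nS D S t * eps D (k * t) := by
  have hS' : S = (U D).filter (fun s => s ∈ S) := by
    rw [Finset.filter_mem_eq_inter, Finset.inter_eq_right.mpr hS]
  unfold sig
  conv_lhs => rw [hS']
  rw [Finset.sum_filter, sum_pairs hC]
  apply Finset.sum_congr rfl
  intro t ht
  exact pair_term hC S k hk t (c_Rf_sub_U hC t ht)

/-! ### The functionals -/

/-- The finset form of the pairing equals the list form. -/
theorem w_eq_wL (q : List (ℕ × ℤ)) (t : ℕ) : w D q t = wL D q t := by
  unfold w wL U
  rw [List.sum_toFinset _ (c_units_nodup hC)]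

/-- Pairing a functional with the signatures of `S ⊆ U`: `Σ_k q(k) sig S k = Σ_{t ∈ R} n_S(t) w_q(t)`. -/
theorem dot_eq (S : Finset ℕ) (hS : S ⊆ U D) (q : List (ℕ × ℤ)) :
    ∑ k ∈ U D, qval q k * sig D S k = ∑ t ∈ Rf D, nS D S t * w D q t := by
  unfold w
  calc ∑ k ∈ U D, qval q k * sig D S k
      = ∑ k ∈ U D, ∑ t ∈ Rf D, qval q k * (nS D S t * eps D (k * t)) := by
        apply Finset.sum_congr rfl
        intro k hk
        rw [sig_eq_sum_R hC S hS k (List.mem_toFinset.mp hk), Finset.mul_sum]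
    _ = ∑ t ∈ Rf D, ∑ k ∈ U D, nS D S t * (qval q k * eps D (k * t)) := by
        rw [Finset.sum_comm]
        apply Finset.sum_congr rfl; intro t _; apply Finset.sum_congr rfl; intro k _; ring
    _ = ∑ t ∈ Rf D, nS D S t * ∑ k ∈ U D, qval q k * eps D (k * t) := by
        apply Finset.sum_congr rfl; intro t _; rw [Finset.mul_sum]

end

/-! ### The block method -/

section
variable (hF : Facts D)
include hF

/-- For an entry `(a, b, q)` of the table: `Σ_{t ∈ R} n_S(t) w_q(t) = d (n_S(a) − n_S(b))`. -/
theorem sum_nw (S : Finset ℕ) (e : ℕ × ℕ × List (ℕ × ℤ)) (he : e ∈ D.qtab) :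
    ∑ t ∈ Rf D, nS D S t * w D e.2.2 t = D.d * (nS D S e.1 - nS D S e.2.1) := by
  obtain ⟨ha, hb, hne⟩ := f_entry hF e he
  have ha' : e.1 ∈ Rf D := List.mem_toFinset.mpr ha
  have hb' : e.2.1 ∈ Rf D := List.mem_toFinset.mpr hb
  calc ∑ t ∈ Rf D, nS D S t * w D e.2.2 t
      = ∑ t ∈ Rf D, ((if t = e.1 then D.d * nS D S t else 0) + (if t = e.2.1 then -D.d * nS D S t else 0)) := by
        apply Finset.sum_congr rfl
        intro t ht
        rw [w_eq_wL (f_core hF), f_w_table hF e he t (List.mem_toFinset.mp ht)]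
        by_cases h1 : t = e.1
        · subst h1
          simp only [ite_true, if_neg hne, add_zero]
          ring
        · by_cases h2 : t = e.2.1
          · subst h2
            simp only [ite_true, if_neg h1, zero_add]
            ring
          · simp only [if_neg h1, if_neg h2, mul_zero, add_zero]
    _ = D.d * (nS D S e.1 - nS D S e.2.1) := by
        rw [Finset.sum_add_distrib, Finset.sum_ite_eq', Finset.sum_ite_eq']
        simp [ha', hb']
        ring

/-- A balanced `S ⊆ U` has `n_S(a) = n_S(b)` for every entry `(a, b, q)` of the table. -/
theorem n_entry (S : Finset ℕ) (hS : S ⊆ U D) (hb : Balanced D S) :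
    ∀ e ∈ D.qtab, nS D S e.1 = nS D S e.2.1 := by
  intro e he
  have h0 : ∑ k ∈ U D, qval e.2.2 k * sig D S k = 0 := by
    apply Finset.sum_eq_zero
    intro k hk
    rw [(balanced_iff_sig S).mp hb k (List.mem_toFinset.mp hk), mul_zero]
  rw [dot_eq (f_core hF) S hS, sum_nw hF S e he] at h0
  have hd := f_d hF
  have : nS D S e.1 - nS D S e.2.1 = 0 := by
    rcases mul_eq_zero.mp h0 with h | h
    · exact absurd h hd
    · exact h
  linarith

/-- THE BLOCK THEOREM (one direction): on a balanced `S ⊆ U`, `n_S` is constant on each coset `cH`. -/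
theorem n_const_of_balanced (S : Finset ℕ) (hS : S ⊆ U D) (hb : Balanced D S) :
    ∀ c ∈ D.creps, ∀ t ∈ coset D c, nS D S t = nS D S c := by
  intro c hc t ht
  exact const_of_chainedB D (nS D S) (n_entry hF S hS hb) (coset D c) (f_chain hF c hc) t ht c
    (f_creps_mem_coset hF c hc)

/-- The converse: if `n_S` is constant on each coset `cH`, then `S ⊆ U` is balanced. -/
theorem balanced_of_n_const (S : Finset ℕ) (hS : S ⊆ U D)
    (h : ∀ c ∈ D.creps, ∀ t ∈ coset D c, nS D S t = nS D S c) : Balanced D S := by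
  rw [balanced_iff_sig]
  intro k hk
  rw [sig_eq_sum_R (f_core hF) S hS k hk]
  have hz : ∀ c ∈ D.creps, ((coset D c).map (fun t => nS D S t * eps D (k * t))).sum = 0 := by
    intro c hc
    have hmap : (coset D c).map (fun t => nS D S t * eps D (k * t)) =
        (coset D c).map (fun t => nS D S c * eps D (k * t)) := by
      apply List.map_congr_left
      intro t ht
      rw [h c hc t ht]
    rw [hmap, List.sum_map_mul_left, f_coset_sig hF c hc k hk, mul_zero]
  unfold Rf
  rw [List.sum_toFinset _ (c_R_nodup (f_core hF))]
  unfold R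
  rw [List.map_flatten, List.sum_flatten]
  apply List.sum_eq_zero
  intro x hx
  simp only [List.map_map, List.mem_map, Function.comp] at hx
  obtain ⟨c, hc, rfl⟩ := hx
  exact hz c hc

/-- THE BLOCK THEOREM: `S ⊆ U` is balanced iff `n_S` is constant on each coset `cH`, `c ∈ creps`. -/
theorem balanced_iff_n_const (S : Finset ℕ) (hS : S ⊆ U D) :
    Balanced D S ↔ ∀ c ∈ D.creps, ∀ t ∈ coset D c, nS D S t = nS D S c :=
  ⟨n_const_of_balanced hF S hS, balanced_of_n_const hF S hS⟩

/-- THE BLOCK THEOREM in set form: `S ⊆ U` is balanced iff on each block it is a union of conjugate pairs, or the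
coset `cH`, or the coset `−cH`. -/
theorem balanced_iff_blocks (S : Finset ℕ) (hS : S ⊆ U D) :
    Balanced D S ↔ ∀ c ∈ D.creps, PairsOn D S c ∨ CosetOn D S c ∨ ConjCosetOn D S c := by
  rw [balanced_iff_n_const hF S hS]
  constructor
  · intro h c hc
    have hc' := h c hc
    rcases nS_cases D S c with h0 | h0 | h0
    · right; right
      intro t ht
      have := hc' t ht
      rw [h0] at this
      unfold nS at this
      by_cases h1 : t ∈ S <;> by_cases h2 : conj D t ∈ S <;> simp_all
    · left
      intro t ht
      have := hc' t ht
      rw [h0] at this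
      unfold nS at this
      by_cases h1 : t ∈ S <;> by_cases h2 : conj D t ∈ S <;> simp_all
    · right; left
      intro t ht
      have := hc' t ht
      rw [h0] at this
      unfold nS at this
      by_cases h1 : t ∈ S <;> by_cases h2 : conj D t ∈ S <;> simp_all
  · intro h c hc t ht
    have hcc := f_creps_mem_coset hF c hc
    rcases h c hc with h1 | h1 | h1
    · have a := h1 t ht; have b := h1 c hcc
      unfold nS
      by_cases ht' : t ∈ S <;> by_cases hc' : c ∈ S <;> simp [ht', hc', a.mp, b.mp, a.not.mp, b.not.mp]
    · obtain ⟨a1, a2⟩ := h1 t ht; obtain ⟨b1, b2⟩ := h1 c hcc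
      unfold nS; simp [a1, a2, b1, b2]
    · obtain ⟨a1, a2⟩ := h1 t ht; obtain ⟨b1, b2⟩ := h1 c hcc
      unfold nS; simp [a1, a2, b1, b2]

end

end HodgeRepro0.P5BlockCensus
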